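import Summits.NavierStokesRegularity.NavierStokesRegularity.Theorems.AxisymmetricExtremalityAxisymmetricKatoGlobalStubSeregin2020TypeIILemma22EnergyClassAcrossAxisV3
import Summits.NavierStokesRegularity.NavierStokesRegularity.Theorems.AxisTwistDoorAveragedConeLiouvilleRadialDrift
import Summits.NavierStokesRegularity.NavierStokesRegularity.Theorems.AxisTwistDoorAveragedConeLiouvilleNUDefs
import Literature.Analysis.FluidPDE.KNSSTypeIRateVertexCylinder
import HarnessLib

/-!
# N4 piece P4a — TOOLS for the energy class of a classical supersolution (translation bookkeeping
# on `ℝ³` and on slabs, the explicit axial field `(2/ϱ)e_ϱ`, slices of jointly `Cⁿ` fields)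

Route `AxisTwistDoor`, crux `AveragedConeLiouville` (stmt-NavierStokesRegularity-26889), INPUT N4
(Nazarov–Ural'tseva 2011 §3 = Lei–Ren–Tian 2025 Lemma 2.5), cut of record pub/ns-inputs STATUS
2026-08-28T11:29:42Z, texts `kits/N4-skeleton.lean` (5372b51f971b2f9d). Folklore tools for the
sibling file `…NUEnergyClass` (`nuEnergyClass_of_supersolution`), whose plan is: the landed across-the-axis energy inequality of the A1 programme
(`energyClass_ineq_acrossAxis_v3`, es-p1 g3, p618452/p620006 — any open set `O`, drift `C¹` and
divergence free OFF the axis, supersolution inequality WITH the axial drift `(2/ϱ)∂_ϱ` OFF the axis,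
hypothesis `Φ ≥ k` ON the axis) is applied to the TRANSLATED data `Ψ(t,y) = Φ(t, y − c)`,
`c = 2R' e₀`, on the ball `B(c, R')`, which does not meet the axis (`ϱ > R'` there): the on-axis
hypothesis is vacuous, and the axial drift is cancelled by the explicit divergence-free field
`−(2/ϱ)e_ϱ = −(2/ϱ²)x_h` (`…RadialDrift`, cas-k2, p622656: `C¹`, bounded by `2/R'`, divergence free
off the axis), i.e. the theorem is used with the drift `W = U(·, · − c) − (2/ϱ)e_ϱ`, for which
`DΨ[W] + (2/ϱ)∂_ϱΨ = DΦ[U]`. Its drift and axis integrals then add up to the `U`-drift integral, and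
every integral is translated back by `y ↦ y + c` (Lebesgue measure on `ℝ × ℝ³` is translation
invariant; the slab `[t₁,t₂] × ℝ³` is invariant).

WHAT THIS IS NOT: not a statement about Navier–Stokes; N4 is an INPUT; item 26889 and the summit
stay open. [cite: NazarovUraltseva2011HarnackDivFree, §3 (3.2), (3.9) (arXiv:1011.1888 pp. 8–9)]
-/

noncomputable section

-- the summit and its single sub-problem share the name (CONVENTIONS §1)
set_option linter.dupNamespace false

open MeasureTheory Set Function Filter Topology Metric
open scoped NNReal ENNReal InnerProductSpace RealInnerProductSpace Laplacian
open Literature.Analysis Literature.Analysis.FluidPDE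
open Summit.NavierStokesRegularity.NavierStokesRegularity.Theorems.AxisymmetricKatoGlobal.EulerScaling
open Summit.NavierStokesRegularity.NavierStokesRegularity.Theorems.AveragedConeLiouville.RadialDrift

namespace Summit.NavierStokesRegularity.NavierStokesRegularity.Theorems.AveragedConeLiouville.NUPositivity

/-! ### Translation bookkeeping on `ℝ³` and on the slab `A × ℝ³` -/

/-- Translation commutes with the derivative: `D(f(· − c))(y) = Df(y − c)` (no differentiability
needed: translation is a diffeomorphism). [folklore] -/
theorem fderiv_comp_sub_const' {F : Type*} [NormedAddCommGroup F] [NormedSpace ℝ F]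
    (f : EuclideanSpace ℝ (Fin 3) → F) (c y : EuclideanSpace ℝ (Fin 3)) :
    fderiv ℝ (fun w => f (w - c)) y = fderiv ℝ f (y - c) := by
  simpa [sub_eq_add_neg] using fderiv_comp_add_right (f := f) (x := y) (-c)

/-- Translation commutes with the gradient. [folklore] -/
theorem gradient_comp_sub_const (f : EuclideanSpace ℝ (Fin 3) → ℝ) (c y : EuclideanSpace ℝ (Fin 3)) :
    gradient (fun w => f (w - c)) y = gradient f (y - c) := by
  rw [gradient, gradient, fderiv_comp_sub_const']

/-- Translation commutes with the Laplacian. [folklore] -/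
theorem laplacian_comp_sub_const (f : EuclideanSpace ℝ (Fin 3) → ℝ) (c y : EuclideanSpace ℝ (Fin 3)) :
    (Δ (fun w => f (w - c))) y = (Δ f) (y - c) := by
  rw [InnerProductSpace.laplacian_eq_iteratedFDeriv_stdOrthonormalBasis,
    InnerProductSpace.laplacian_eq_iteratedFDeriv_stdOrthonormalBasis]
  simp only [sub_eq_add_neg, iteratedFDeriv_comp_add_right]

/-- A Bochner integral over the slab `A × ℝ³` is invariant under the spatial translation
`y ↦ y − c` of the integrand. [folklore] -/
theorem setIntegral_prod_univ_comp_sub_right {A : Set ℝ} (hA : MeasurableSet A)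
    (F : ℝ × EuclideanSpace ℝ (Fin 3) → ℝ) (c : EuclideanSpace ℝ (Fin 3)) :
    ∫ z in A ×ˢ (univ : Set (EuclideanSpace ℝ (Fin 3))), F (z.1, z.2 - c) =
      ∫ z in A ×ˢ (univ : Set (EuclideanSpace ℝ (Fin 3))), F z := by
  have hAm : MeasurableSet (A ×ˢ (univ : Set (EuclideanSpace ℝ (Fin 3)))) := hA.prod MeasurableSet.univ
  rw [← integral_indicator hAm, ← integral_indicator hAm]
  have h : (A ×ˢ (univ : Set (EuclideanSpace ℝ (Fin 3)))).indicator
      (fun z : ℝ × EuclideanSpace ℝ (Fin 3) => F (z.1, z.2 - c)) =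
      fun z => (A ×ˢ (univ : Set (EuclideanSpace ℝ (Fin 3)))).indicator F
        (z - ((0 : ℝ), c)) := by
    funext z
    by_cases hz : z ∈ A ×ˢ (univ : Set (EuclideanSpace ℝ (Fin 3)))
    · have hz' : z - ((0 : ℝ), c) ∈ A ×ˢ (univ : Set (EuclideanSpace ℝ (Fin 3))) :=
        ⟨by simpa using hz.1, mem_univ _⟩
      rw [indicator_of_mem hz, indicator_of_mem hz']
      congr 1
      ext <;> simp
    · have hz' : z - ((0 : ℝ), c) ∉ A ×ˢ (univ : Set (EuclideanSpace ℝ (Fin 3))) :=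
        fun h => hz ⟨by simpa using h.1, mem_univ _⟩
      rw [indicator_of_notMem hz, indicator_of_notMem hz']
  haveI : (volume : Measure (ℝ × EuclideanSpace ℝ (Fin 3))).IsAddLeftInvariant := by
    change ((volume : Measure ℝ).prod (volume : Measure (EuclideanSpace ℝ (Fin 3)))).IsAddLeftInvariant
    infer_instance
  rw [h]
  simp_rw [sub_eq_neg_add]
  exact integral_add_left_eq_self _ _

/-- A lower Lebesgue integral over the slab `A × ℝ³` is invariant under the spatial translation
`y ↦ y − c` of the integrand. [folklore] -/
theorem setLIntegral_prod_univ_comp_sub_right {A : Set ℝ} (hA : MeasurableSet A)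
    (F : ℝ × EuclideanSpace ℝ (Fin 3) → ℝ≥0∞) (c : EuclideanSpace ℝ (Fin 3)) :
    ∫⁻ z in A ×ˢ (univ : Set (EuclideanSpace ℝ (Fin 3))), F (z.1, z.2 - c) =
      ∫⁻ z in A ×ˢ (univ : Set (EuclideanSpace ℝ (Fin 3))), F z := by
  have hAm : MeasurableSet (A ×ˢ (univ : Set (EuclideanSpace ℝ (Fin 3)))) := hA.prod MeasurableSet.univ
  rw [← lintegral_indicator hAm, ← lintegral_indicator hAm]
  have h : (A ×ˢ (univ : Set (EuclideanSpace ℝ (Fin 3)))).indicator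
      (fun z : ℝ × EuclideanSpace ℝ (Fin 3) => F (z.1, z.2 - c)) =
      fun z => (A ×ˢ (univ : Set (EuclideanSpace ℝ (Fin 3)))).indicator F
        (z - ((0 : ℝ), c)) := by
    funext z
    by_cases hz : z ∈ A ×ˢ (univ : Set (EuclideanSpace ℝ (Fin 3)))
    · have hz' : z - ((0 : ℝ), c) ∈ A ×ˢ (univ : Set (EuclideanSpace ℝ (Fin 3))) :=
        ⟨by simpa using hz.1, mem_univ _⟩
      rw [indicator_of_mem hz, indicator_of_mem hz']
      congr 1
      ext <;> simp
    · have hz' : z - ((0 : ℝ), c) ∉ A ×ˢ (univ : Set (EuclideanSpace ℝ (Fin 3))) :=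
        fun h => hz ⟨by simpa using h.1, mem_univ _⟩
      rw [indicator_of_notMem hz, indicator_of_notMem hz']
  haveI : (volume : Measure (ℝ × EuclideanSpace ℝ (Fin 3))).IsAddLeftInvariant := by
    change ((volume : Measure ℝ).prod (volume : Measure (EuclideanSpace ℝ (Fin 3)))).IsAddLeftInvariant
    infer_instance
  rw [h]
  simp_rw [sub_eq_neg_add]
  exact lintegral_add_left_eq_self _ _

/-! ### The explicit axial field `(2/ϱ) e_ϱ = (2/ϱ²) x_h` -/

/-- `(2/ϱ) e_ϱ = (2/ϱ²) x_h` everywhere (both sides vanish on the axis by the junk value `0⁻¹ = 0`). [folklore] -/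
theorem two_div_cylRadius_smul_eR (y : EuclideanSpace ℝ (Fin 3)) :
    (2 / cylRadius y) • eR y =
      (2 / cylRadius y ^ 2) • (y 0 • EuclideanSpace.single (0 : Fin 3) (1 : ℝ) +
        y 1 • EuclideanSpace.single (1 : Fin 3) (1 : ℝ)) := by
  have hvec : (WithLp.toLp 2 ![y 0, y 1, 0] : EuclideanSpace ℝ (Fin 3)) =
      y 0 • EuclideanSpace.single (0 : Fin 3) (1 : ℝ) + y 1 • EuclideanSpace.single (1 : Fin 3) (1 : ℝ) := by
    ext i
    fin_cases i <;> simp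
  rw [eR, hvec, smul_smul]
  congr 1
  rw [pow_two]
  ring

/-- `|y₀| ≤ ‖y‖` in `ℝ³`. [folklore] -/
theorem abs_apply_zero_le_norm (y : EuclideanSpace ℝ (Fin 3)) : |y 0| ≤ ‖y‖ := by
  rw [EuclideanSpace.norm_eq, ← Real.sqrt_sq_eq_abs]
  refine Real.sqrt_le_sqrt ?_
  rw [Fin.sum_univ_three]
  simp only [Real.norm_eq_abs, sq_abs]
  nlinarith [sq_nonneg (y 1), sq_nonneg (y 2)]

/-- On the ball `B(2R' e₀, R')` the cylindrical radius exceeds `R'`. [folklore] -/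
theorem lt_cylRadius_of_mem_ball {R' : ℝ} {y : EuclideanSpace ℝ (Fin 3)}
    (hy : y ∈ ball (EuclideanSpace.single (0 : Fin 3) (2 * R')) R') : R' < cylRadius y := by
  have h1 : |(y - EuclideanSpace.single (0 : Fin 3) (2 * R')) 0| < R' :=
    lt_of_le_of_lt (abs_apply_zero_le_norm _) (mem_ball_iff_norm.1 hy)
  have h2 : (y - EuclideanSpace.single (0 : Fin 3) (2 * R')) 0 = y 0 - 2 * R' := by simp
  rw [h2] at h1
  have h3 : R' < y 0 := by
    have := (abs_lt.1 h1).1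
    linarith
  exact lt_of_lt_of_le (lt_of_lt_of_le h3 (le_abs_self _)) (abs_apply_zero_le_cylRadius y)


/-! ### Slices of a jointly `Cⁿ` field on an open space–time set -/

/-- Spatial slices of a jointly `Cⁿ` field are `Cⁿ`. [folklore] -/
theorem contDiffAt_slice_of_contDiffOn {F : Type*} [NormedAddCommGroup F] [NormedSpace ℝ F]
    {S : Set (ℝ × EuclideanSpace ℝ (Fin 3))} (hS : IsOpen S) {f : ℝ → EuclideanSpace ℝ (Fin 3) → F}
    {n : WithTop ℕ∞} (hf : ContDiffOn ℝ n (uncurry f) S) {z : ℝ × EuclideanSpace ℝ (Fin 3)}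
    (hz : z ∈ S) : ContDiffAt ℝ n (f z.1) z.2 := by
  have h1 : ContDiffAt ℝ n (uncurry f) (z.1, z.2) := hf.contDiffAt (hS.mem_nhds hz)
  have h2 : ContDiffAt ℝ n (fun x : EuclideanSpace ℝ (Fin 3) => (z.1, x)) z.2 :=
    contDiffAt_const.prodMk contDiffAt_id
  exact h1.comp z.2 h2

/-- Time lines of a jointly `C¹` field are differentiable. [folklore] -/
theorem hasDerivAt_timeLine_of_contDiffOn {F : Type*} [NormedAddCommGroup F] [NormedSpace ℝ F]
    {S : Set (ℝ × EuclideanSpace ℝ (Fin 3))} (hS : IsOpen S) {f : ℝ → EuclideanSpace ℝ (Fin 3) → F}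
    {n : WithTop ℕ∞} (hf : ContDiffOn ℝ n (uncurry f) S) (hn : 1 ≤ n)
    {z : ℝ × EuclideanSpace ℝ (Fin 3)} (hz : z ∈ S) :
    HasDerivAt (fun r => f r z.2) (fderiv ℝ (uncurry f) z ((1 : ℝ), (0 : EuclideanSpace ℝ (Fin 3)))) z.1 := by
  have h1 : HasFDerivAt (uncurry f) (fderiv ℝ (uncurry f) z) (z.1, z.2) :=
    ((hf.contDiffAt (hS.mem_nhds hz)).differentiableAt (fun h => by simp [h] at hn)).hasFDerivAt
  have h2 : HasFDerivAt (fun r : ℝ => (r, z.2)) (ContinuousLinearMap.inl ℝ ℝ (EuclideanSpace ℝ (Fin 3))) z.1 :=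
    hasFDerivAt_prodMk_left z.1 z.2
  have h3 := (h1.comp z.1 h2).hasDerivAt
  have e : (uncurry f ∘ fun r : ℝ => (r, z.2)) = fun r => f r z.2 := rfl
  rw [e] at h3
  simpa using h3

/-- Spatial slices of a jointly `C¹` field: the slice derivative is the joint derivative
restricted to `{0} × ℝ³`. [folklore] -/
theorem hasFDerivAt_slice_of_contDiffOn {F : Type*} [NormedAddCommGroup F] [NormedSpace ℝ F]
    {S : Set (ℝ × EuclideanSpace ℝ (Fin 3))} (hS : IsOpen S) {f : ℝ → EuclideanSpace ℝ (Fin 3) → F}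
    {n : WithTop ℕ∞} (hf : ContDiffOn ℝ n (uncurry f) S) (hn : 1 ≤ n)
    {z : ℝ × EuclideanSpace ℝ (Fin 3)} (hz : z ∈ S) :
    HasFDerivAt (f z.1) ((fderiv ℝ (uncurry f) z).comp
      (ContinuousLinearMap.inr ℝ ℝ (EuclideanSpace ℝ (Fin 3)))) z.2 := by
  have h1 : HasFDerivAt (uncurry f) (fderiv ℝ (uncurry f) z) (z.1, z.2) :=
    ((hf.contDiffAt (hS.mem_nhds hz)).differentiableAt (fun h => by simp [h] at hn)).hasFDerivAt
  have h2 : HasFDerivAt (fun x : EuclideanSpace ℝ (Fin 3) => (z.1, x))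
      (ContinuousLinearMap.inr ℝ ℝ (EuclideanSpace ℝ (Fin 3))) z.2 :=
    hasFDerivAt_prodMk_right z.1 z.2
  exact h1.comp z.2 h2

/-- Joint continuity of the slice derivative of a jointly `C¹` field. [folklore] -/
theorem continuousOn_fderiv_slice_of_contDiffOn {F : Type*} [NormedAddCommGroup F] [NormedSpace ℝ F]
    {S : Set (ℝ × EuclideanSpace ℝ (Fin 3))} (hS : IsOpen S) {f : ℝ → EuclideanSpace ℝ (Fin 3) → F}
    {n : WithTop ℕ∞} (hf : ContDiffOn ℝ n (uncurry f) S) (hn : 1 ≤ n) :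
    ContinuousOn (fun z : ℝ × EuclideanSpace ℝ (Fin 3) => fderiv ℝ (f z.1) z.2) S := by
  have hc : ContinuousOn (fun z : ℝ × EuclideanSpace ℝ (Fin 3) => (fderiv ℝ (uncurry f) z).comp
      (ContinuousLinearMap.inr ℝ ℝ (EuclideanSpace ℝ (Fin 3)))) S :=
    (hf.continuousOn_fderiv_of_isOpen hS hn).clm_comp continuousOn_const
  refine hc.congr fun z hz => ?_
  exact (hasFDerivAt_slice_of_contDiffOn hS hf hn hz).fderiv

/-- Joint continuity of the time derivative of a jointly `C¹` field. [folklore] -/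
theorem continuousOn_deriv_timeLine_of_contDiffOn {F : Type*} [NormedAddCommGroup F] [NormedSpace ℝ F]
    {S : Set (ℝ × EuclideanSpace ℝ (Fin 3))} (hS : IsOpen S) {f : ℝ → EuclideanSpace ℝ (Fin 3) → F}
    {n : WithTop ℕ∞} (hf : ContDiffOn ℝ n (uncurry f) S) (hn : 1 ≤ n) :
    ContinuousOn (fun z : ℝ × EuclideanSpace ℝ (Fin 3) => deriv (fun r => f r z.2) z.1) S := by
  have hc : ContinuousOn (fun z : ℝ × EuclideanSpace ℝ (Fin 3) =>
      fderiv ℝ (uncurry f) z ((1 : ℝ), (0 : EuclideanSpace ℝ (Fin 3)))) S :=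
    (hf.continuousOn_fderiv_of_isOpen hS hn).clm_apply continuousOn_const
  refine hc.congr fun z hz => ?_
  exact (hasDerivAt_timeLine_of_contDiffOn hS hf hn hz).deriv


end Summit.NavierStokesRegularity.NavierStokesRegularity.Theorems.AveragedConeLiouville.NUPositivity

end
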